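import Mathlib
import Literature.Geometry.Symplectic.JHolomorphicCuspDoublePoints
import Literature.Geometry.Symplectic.JHolomorphicCuspPushoff
import Literature.Geometry.Symplectic.JHolomorphicCriticalPointsIsolated
import HarnessLib

/-!
# Double points of perturbed cusps, V: McDuff's Theorem 1.4 in the critical chart

Fifth file of the flat-model proof of D. McDuff's theorem that `C¹`-small `J`-holomorphic
immersed perturbations of a cuspidal `J`-holomorphic disc have double points (D. McDuff, *The
local behaviour of holomorphic curves in almost complex 4-manifolds*, J. Differential Geom. 34
(1991), Thm 1.4 with Cor. 4.4 and (5.6)). It assembles the degree argument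
(`not_injOn_of_perturbed_cusp`, `JHolomorphicCuspDoublePoints.lean`) and the complex-normal
push-off fields (`exists_pushoffSelector`, `JHolomorphicCuspPushoff.lean`) into the statement
of the theorem in the chart `ℂ × ℂ` of the critical point:

* `not_injOn_of_chartCusp` — for a continuous almost complex structure `J̃` near `0` whose value
  at `0` preserves the tangent line, and the cusp `F = (wᵏ, û)` (`k ≥ 2`) with holomorphic
  leading terms of its branch differences (Wendl 2020, Thm B.23), tangent planes converging to
  the tangent line at rate `‖dû(w)‖ = O(|w|ᵏ)` (McDuff 1991, Lemma 2.7; Wendl 2020, Cor. B.21),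
  injective near `0`, immersed off `0`, with `J̃`-complex tangent planes: every `C¹` map `g`
  which is `C¹`-close to `F` on a small closed disc, immersed, with `J̃`-complex tangent planes,
  is not injective on that disc.

Helpers: `exists_intertwiner` (a `J`-complex plane is the range of an `i`-`J` intertwiner),
`cone_transversal`, `exists_bound_below_of_injective`, `natAbs_wind_deriv_pow`.

Everything is proved; there are no definitions and no named facts.

## References

* D. McDuff, *The local behaviour of holomorphic curves in almost complex 4-manifolds*,
  J. Differential Geom. 34 (1991) 143–164, Thm 1.4, Lemma 2.7, Cor. 4.4, (5.6).
  [McDuff1991LocalBehaviour]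
* C. Wendl, *Lectures on Contact 3-Manifolds, Holomorphic Curves and Intersection Theory*,
  Cambridge Tracts in Math. 220 (2020), App. B, Cor. B.21, Thm B.23. [Wendl2020]
* J. Milnor, *Topology from the Differentiable Viewpoint* (1965), §6. [MilnorTDV1965]
-/

noncomputable section

open scoped Real ComplexConjugate Topology
open Complex Set Filter Metric Asymptotics Literature.Topology.PlaneTopology

namespace Literature.Geometry.Symplectic

namespace CuspDoublePoints

/-! ### Linear-algebra helpers -/

section Helpers

variable {V : Type*} [NormedAddCommGroup V] [NormedSpace ℝ V]

/-- A `J`-invariant plane `range D` (`D : ℂ → V` injective real-linear) is the range of an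
`i`-`J`-intertwining real-linear map `L` with `L 1 = D 1`. [folklore] -/
theorem exists_intertwiner (J : V →L[ℝ] V) (hJ : ∀ v, J (J v) = -v) (D : ℂ →L[ℝ] V)
    (hD : Function.Injective D)
    (hinv : ∀ c : ℂ, J (D c) ∈ LinearMap.range (D : ℂ →ₗ[ℝ] V)) :
    ∃ L : ℂ →L[ℝ] V, (∀ c : ℂ, L (I * c) = J (L c)) ∧ L 1 = D 1 ∧
      LinearMap.range (L : ℂ →ₗ[ℝ] V) = LinearMap.range (D : ℂ →ₗ[ℝ] V) := by
  set v : V := D 1 with hv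
  have hv0 : v ≠ 0 := by
    intro h0; exact one_ne_zero (hD (by rw [map_zero]; exact h0))
  have hDc : ∀ c : ℂ, D c = (c.re : ℝ) • v + (c.im : ℝ) • D I := by
    intro c
    have e : c = (c.re : ℝ) • (1 : ℂ) + (c.im : ℝ) • I := by
      simp only [real_smul, mul_one]; exact (re_add_im c).symm
    conv_lhs => rw [e]
    rw [map_add, map_smul, map_smul]
  obtain ⟨c₁, hc₁⟩ := hinv 1
  have hc₁' : J v = (c₁.re : ℝ) • v + (c₁.im : ℝ) • D I := by
    rw [hv, ← hDc c₁]; exact hc₁.symm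
  have him : c₁.im ≠ 0 := by
    intro h0
    rw [h0, zero_smul, add_zero] at hc₁'
    have : (c₁.re : ℝ) • v + (-1 : ℝ) • J v = 0 := by rw [hc₁', neg_one_smul, add_neg_cancel]
    have := (CriticalPoints.eq_zero_of_smul_add_smul_eq_zero J hJ hv0 this).2
    norm_num at this
  set L : ℂ →L[ℝ] V := reCLM.smulRight v + imCLM.smulRight (J v) with hL
  have hLapp : ∀ c : ℂ, L c = (c.re : ℝ) • v + (c.im : ℝ) • J v := fun c => by simp [hL]
  have hDI : D I = (c₁.im⁻¹ : ℝ) • (J v - (c₁.re : ℝ) • v) := by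
    rw [hc₁', add_sub_cancel_left, smul_smul, inv_mul_cancel₀ him, one_smul]
  have hJv : J v = D c₁ := by rw [hv]; exact hc₁.symm
  have hL1 : L 1 = v := by rw [hLapp]; simp
  have hLI : L I = J v := by rw [hLapp]; simp
  refine ⟨L, fun c => ?_, hL1, le_antisymm ?_ ?_⟩
  · rw [hLapp, hLapp, map_add, map_smul, map_smul, hJ]
    simp only [mul_re, I_re, zero_mul, I_im, one_mul, zero_sub, mul_im, neg_smul, smul_neg]
    abel
  · rintro _ ⟨c, rfl⟩
    refine ⟨(c.re : ℝ) • (1 : ℂ) + (c.im : ℝ) • c₁, ?_⟩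
    change D _ = L c
    rw [map_add, map_smul, map_smul, hLapp, hJv]
  · rintro _ ⟨c, rfl⟩
    have hLq₀ : L ((c₁.im⁻¹ : ℝ) • (I - (c₁.re : ℝ) • (1 : ℂ))) = D I := by
      rw [map_smul, map_sub, map_smul, hLI, hL1, hDI]
    refine ⟨(c.re : ℝ) • (1 : ℂ) + (c.im : ℝ) • ((c₁.im⁻¹ : ℝ) • (I - (c₁.re : ℝ) • (1 : ℂ))), ?_⟩
    change L _ = D c
    rw [map_add, map_smul, map_smul, hL1, hLq₀, ← hDc]

/-- **Cone transversality.** If the plane `T` lies in the cone `‖x₂‖ ≤ η ‖x₁‖`, the vector `e`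
is not in `T` and satisfies `‖e₁‖ ≤ B ‖e₂‖` with `η B < 1`, then none of the vectors
`(l e₁, e₂)`, `0 ≤ l ≤ 1`, lies in `T`. [folklore] -/
theorem cone_transversal {T : Submodule ℝ (ℂ × ℂ)} {η B : ℝ} (hη : 0 ≤ η)
    (hT : ∀ x ∈ T, ‖x.2‖ ≤ η * ‖x.1‖) {e : ℂ × ℂ} (he : e ∉ T) (hB : ‖e.1‖ ≤ B * ‖e.2‖)
    (hηB : η * B < 1) : ∀ l ∈ Icc (0 : ℝ) 1, (((l : ℂ) * e.1, e.2) : ℂ × ℂ) ∉ T := by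
  intro l hl hmem
  have h1 := hT _ hmem
  simp only [norm_mul, norm_real, Real.norm_of_nonneg hl.1] at h1
  -- `‖e₂‖ ≤ η l ‖e₁‖ ≤ η B ‖e₂‖`
  have h2 : ‖e.2‖ ≤ η * B * ‖e.2‖ := by
    calc ‖e.2‖ ≤ η * (l * ‖e.1‖) := h1
      _ ≤ η * (1 * ‖e.1‖) := by gcongr; exact hl.2
      _ ≤ η * (B * ‖e.2‖) := by rw [one_mul]; exact mul_le_mul_of_nonneg_left hB hη
      _ = η * B * ‖e.2‖ := by ring
  have he2 : e.2 = 0 := by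
    have : (1 - η * B) * ‖e.2‖ ≤ 0 := by nlinarith [norm_nonneg e.2]
    have h3 : ‖e.2‖ ≤ 0 := by
      by_contra h4; push Not at h4
      have : 0 < (1 - η * B) * ‖e.2‖ := mul_pos (by linarith) h4
      linarith
    exact norm_le_zero_iff.1 h3
  have he1 : e.1 = 0 := by
    have : ‖e.1‖ ≤ 0 := by simpa [he2] using hB
    exact norm_le_zero_iff.1 this
  exact he (by rw [show e = 0 from Prod.ext he1 he2]; exact T.zero_mem)

/-- An injective real-linear endomorphism of `ℂ` is bounded below. [folklore] -/
theorem exists_bound_below_of_injective (G : ℂ →L[ℝ] ℂ) (hG : Function.Injective G) :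
    ∃ c > 0, ∀ a : ℂ, c * ‖a‖ ≤ ‖G a‖ := by
  set Ge : ℂ ≃L[ℝ] ℂ :=
    (LinearEquiv.ofInjectiveEndo (G : ℂ →ₗ[ℝ] ℂ) hG).toContinuousLinearEquiv with hGe
  have hGe_apply : ∀ a, Ge a = G a := fun a => rfl
  refine ⟨(‖(Ge.symm : ℂ →L[ℝ] ℂ)‖ + 1)⁻¹, by positivity, fun a => ?_⟩
  have h1 : ‖a‖ ≤ ‖(Ge.symm : ℂ →L[ℝ] ℂ)‖ * ‖G a‖ := by
    have := (Ge.symm : ℂ →L[ℝ] ℂ).le_opNorm (Ge a)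
    rwa [ContinuousLinearEquiv.coe_coe, Ge.symm_apply_apply, hGe_apply] at this
  rw [inv_mul_le_iff₀ (by positivity)]
  nlinarith [norm_nonneg (G a), norm_nonneg (Ge.symm : ℂ →L[ℝ] ℂ)]

/-- `|wind|` of `t ↦ k (r e^{2πit})^{k-1}` is `k - 1`. [folklore] -/
theorem natAbs_wind_deriv_pow {r : ℝ} (hr : 0 < r) {k : ℕ} (hk : 1 ≤ k) :
    (wind fun t => (k : ℂ) * circleLoop 0 r t ^ (k - 1)).natAbs = k - 1 := by
  have hk0 : (k : ℂ) ≠ 0 := Nat.cast_ne_zero.2 (by omega)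
  have hl : IsNonvanishingLoop (circleLoop 0 r) :=
    isNonvanishingLoop_circleLoop (by rw [norm_zero, abs_of_pos hr]; exact hr.ne)
  have hp : IsNonvanishingLoop fun t => circleLoop 0 r t ^ (k - 1) := by
    have := hl.zpow ((k - 1 : ℕ) : ℤ)
    simpa only [zpow_natCast] using this
  have h1 : wind (fun t => (k : ℂ) * circleLoop 0 r t ^ (k - 1)) = ((k - 1 : ℕ) : ℤ) := by
    rw [wind_mul (IsNonvanishingLoop.const hk0) hp, wind_const, zero_add, wind_circleLoop_pow hr]
  rw [h1, Int.natAbs_natCast]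

end Helpers

/-! ### McDuff's Theorem 1.4 in the critical chart -/

/-- **Perturbed cusps have double points (McDuff 1991, Thm 1.4 with Cor. 4.4 / (5.6), in the
critical chart).** In the chart `ℂ × ℂ` of a critical point let `J̃` be a continuous almost
complex structure near `0` whose value at `0` preserves the tangent line `ℂ × {0}`, and let
`F(w) = (wᵏ, û(w))` (`k ≥ 2`, `û ∈ C¹`, `û(0) = 0`) be the cusp, with: holomorphic leading terms
of the branch differences, `û(w) - û(μw) + C_μ w^{m_μ} = o(|w|^{m_μ})`, `C_μ ≠ 0`,
`m_μ ≥ k - 1`, `Σ_μ m_μ > k - 1` (Wendl 2020, Thm B.23); tangent planes converging to the tangent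
line at the rate `‖dû(w)‖ = O(|w|ᵏ)` (McDuff 1991, Lemma 2.7 / Wendl 2020, Cor. B.21); `F`
injective near `0` and immersed off `0`; and `J̃`-complex tangent planes. Then there are `s > 0`
and `δ > 0` such that every `C¹` map `g`, `δ`-close to `F` in `C¹` on the closed `s`-disc, with
injective differentials whose images are `J̃(g(w))`-complex lines, is NOT injective on the closed
`s`-disc. (Proof: push-off fields from `exists_pushoffSelector` feed
`not_injOn_of_perturbed_cusp`.) [cite: McDuff1991LocalBehaviour, Thm 1.4, Cor. 4.4, (5.6)] -/
theorem not_injOn_of_chartCusp {k : ℕ} (hk : 2 ≤ k) {C : ℂ → ℂ} {m : ℂ → ℕ}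
    (hC : ∀ μ ∈ (Polynomial.nthRootsFinset k (1 : ℂ)).erase 1, C μ ≠ 0)
    (hm : ∀ μ ∈ (Polynomial.nthRootsFinset k (1 : ℂ)).erase 1, k - 1 ≤ m μ)
    (hsum : ((k - 1 : ℕ) : ℤ) < ∑ μ ∈ (Polynomial.nthRootsFinset k (1 : ℂ)).erase 1, (m μ : ℤ))
    {Jt : ℂ × ℂ → (ℂ × ℂ) →L[ℝ] (ℂ × ℂ)} {W : Set (ℂ × ℂ)} (hW : IsOpen W)
    (h0W : (0 : ℂ × ℂ) ∈ W) (hJc : ContinuousOn Jt W) (hJ2 : ∀ x ∈ W, ∀ v, Jt x (Jt x v) = -v)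
    (hH : ∀ x : ℂ, (Jt 0 (x, 0)).2 = 0)
    {û : ℂ → ℂ} {U : Set ℂ} (hU : IsOpen U) (h0U : (0 : ℂ) ∈ U) (hû : ContDiffOn ℝ 1 û U)
    (hû0 : û 0 = 0)
    (halign : ∀ μ ∈ (Polynomial.nthRootsFinset k (1 : ℂ)).erase 1,
      (fun w => û w - û (μ * w) + C μ * w ^ m μ) =o[𝓝 0] fun w => ‖w‖ ^ m μ)
    (hdû : (fun w => fderiv ℝ û w) =O[𝓝 0] fun w => ‖w‖ ^ k)
    {s₁ : ℝ} (hs₁ : 0 < s₁) (hinj : InjOn (fun z : ℂ => ((z ^ k, û z) : ℂ × ℂ)) (ball 0 s₁))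
    (himm : ∀ w ∈ ball (0 : ℂ) s₁, w ≠ 0 →
      Function.Injective (fderiv ℝ (fun z : ℂ => ((z ^ k, û z) : ℂ × ℂ)) w))
    (hFJ : ∀ w ∈ ball (0 : ℂ) s₁, w ≠ 0 → ∀ c : ℂ,
      Jt (w ^ k, û w) (fderiv ℝ (fun z : ℂ => ((z ^ k, û z) : ℂ × ℂ)) w c) ∈
        LinearMap.range (fderiv ℝ (fun z : ℂ => ((z ^ k, û z) : ℂ × ℂ)) w : ℂ →ₗ[ℝ] ℂ × ℂ)) :
    ∃ s > 0, ∃ δ > 0, closedBall (0 : ℂ) s ⊆ U ∧ ∀ g : ℂ → ℂ × ℂ, ContDiffOn ℝ 1 g U →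
      (∀ w ∈ closedBall (0 : ℂ) s, ‖g w - (w ^ k, û w)‖ ≤ δ) →
      (∀ w ∈ closedBall (0 : ℂ) s,
        ‖fderiv ℝ g w - fderiv ℝ (fun z : ℂ => ((z ^ k, û z) : ℂ × ℂ)) w‖ ≤ δ) →
      (∀ w ∈ closedBall (0 : ℂ) s, Function.Injective (fderiv ℝ g w)) →
      (∀ w ∈ closedBall (0 : ℂ) s, ∀ c : ℂ,
        Jt (g w) (fderiv ℝ g w c) ∈ LinearMap.range (fderiv ℝ g w : ℂ →ₗ[ℝ] ℂ × ℂ)) →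
      ¬ InjOn g (closedBall 0 s) := by
  classical
  -- ### notation
  set Rk := Polynomial.nthRootsFinset k (1 : ℂ) with hRk
  set S := Rk.erase 1 with hS
  set F : ℂ → ℂ × ℂ := fun z => (z ^ k, û z) with hFdef
  set J₀ : (ℂ × ℂ) →L[ℝ] (ℂ × ℂ) := Jt 0 with hJ₀
  have hk0 : 0 < k := by omega
  have hk1 : 1 ≤ k := hk0
  have hJ₀2 : ∀ v, J₀ (J₀ v) = -v := hJ2 0 h0W
  -- ### the push-off selector and its constants
  obtain ⟨E, G₁, G₂, t₀, ht₀, hG₂, hEtrans, hEcont, hEhom, hEmodel⟩ :=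
    exists_pushoffSelector J₀ hJ₀2 hH
  obtain ⟨cG, hcG, hcGle⟩ := exists_bound_below_of_injective G₂ hG₂
  set B : ℝ := 2 * (‖G₁‖ + cG) / cG with hB
  have hBpos : 0 < B := by positivity
  obtain ⟨δE, hδE, hmodel⟩ := hEmodel (cG / 2) (by positivity)
  set δJ : ℝ := min δE t₀ with hδJ
  have hδJpos : 0 < δJ := lt_min hδE ht₀
  have hδJE : δJ ≤ δE := min_le_left _ _
  have hδJt : δJ ≤ t₀ := min_le_right _ _
  -- ### regularity of the cusp
  have hFcd : ContDiffOn ℝ 1 F U := ((contDiff_id.pow k).contDiffOn).prodMk hû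
  set F' : ℂ → (ℂ →L[ℝ] ℂ × ℂ) := fun w =>
    ((ContinuousLinearMap.smulRight (1 : ℂ →L[ℂ] ℂ) ((k : ℂ) * w ^ (k - 1))).restrictScalars ℝ).prod
      (fderiv ℝ û w) with hF'
  have hF'app : ∀ w c, F' w c = ((c * ((k : ℂ) * w ^ (k - 1)), fderiv ℝ û w c) : ℂ × ℂ) := by
    intro w c; simp [hF']
  have hdF : ∀ w ∈ U, HasFDerivAt F (F' w) w := by
    intro w hw
    have h1 : HasFDerivAt (fun z : ℂ => z ^ k)
        ((ContinuousLinearMap.smulRight (1 : ℂ →L[ℂ] ℂ) ((k : ℂ) * w ^ (k - 1))).restrictScalars ℝ)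
        w :=
      (hasDerivAt_pow k w).hasFDerivAt.restrictScalars ℝ
    have h2 : HasFDerivAt û (fderiv ℝ û w) w :=
      ((hû.differentiableOn_one w hw).differentiableAt (hU.mem_nhds hw)).hasFDerivAt
    exact h1.prodMk h2
  have hdFeq : ∀ w ∈ U, fderiv ℝ F w = F' w := fun w hw => (hdF w hw).fderiv
  have hdûc : ContinuousOn (fderiv ℝ û) U := hû.continuousOn_fderiv_of_isOpen hU le_rfl
  have hF'c : ContinuousOn (fun w => F' w 1) U := by
    have : (fun w => F' w 1) =
        fun w => (((1 : ℂ) * ((k : ℂ) * w ^ (k - 1)), fderiv ℝ û w 1) : ℂ × ℂ) :=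
      funext fun w => hF'app w 1
    rw [this]
    exact ((continuous_const.mul (continuous_const.mul (continuous_id.pow _))).continuousOn).prodMk
      (hdûc.clm_apply continuousOn_const)
  have hFc0 : ContinuousAt F 0 := by
    have : ContinuousAt û 0 := hû.continuousOn.continuousAt (hU.mem_nhds h0U)
    exact ((continuous_id.pow k).continuousAt).prodMk this
  have hF0 : F 0 = 0 := by
    simp only [hFdef, hû0, zero_pow hk0.ne']; rfl
  -- ### the radius
  obtain ⟨Cd, hCd, hCdw⟩ := hdû.exists_pos
  set V₀ : Set (ℂ × ℂ) := W ∩ Jt ⁻¹' ball J₀ δJ with hV₀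
  have hV₀open : IsOpen V₀ := hJc.isOpen_inter_preimage hW isOpen_ball
  have h0V₀ : (0 : ℂ × ℂ) ∈ V₀ := ⟨h0W, by simpa [hJ₀] using hδJpos⟩
  have ev1 : ∀ᶠ w in 𝓝 (0 : ℂ), w ∈ U := hU.mem_nhds h0U
  have ev2 : ∀ᶠ w in 𝓝 (0 : ℂ), w ∈ ball (0 : ℂ) s₁ := isOpen_ball.mem_nhds (mem_ball_self hs₁)
  have ev3 : ∀ᶠ w in 𝓝 (0 : ℂ), ‖fderiv ℝ û w‖ ≤ Cd * ‖‖w‖ ^ k‖ := hCdw.bound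
  have ev4 : ∀ᶠ w in 𝓝 (0 : ℂ), ∀ μ ∈ S, ‖û w - û (μ * w) + C μ * w ^ m μ‖ ≤
      ‖C μ‖ / 2 * ‖‖w‖ ^ m μ‖ :=
    (Filter.eventually_all_finset S).2 fun μ hμ =>
      (halign μ hμ).def (half_pos (norm_pos_iff.2 (hC μ hμ)))
  have ev5 : ∀ᶠ w in 𝓝 (0 : ℂ), F w ∈ V₀ := by
    refine hFc0.preimage_mem_nhds ?_
    rw [hF0]; exact hV₀open.mem_nhds h0V₀
  obtain ⟨s₂, hs₂, hs₂sub⟩ :=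
    Metric.eventually_nhds_iff_ball.1 (ev1.and (ev2.and (ev3.and (ev4.and ev5))))
  set s : ℝ := min (s₂ / 2) (min ((k : ℝ) * δE / (2 * Cd)) ((k : ℝ) / (2 * Cd * (B + 1))))
    with hs_def
  have hkpos : (0 : ℝ) < k := by exact_mod_cast hk0
  have hs : 0 < s := lt_min (by positivity) (lt_min (by positivity) (by positivity))
  have hss₂ : s < s₂ := by
    have : s ≤ s₂ / 2 := min_le_left _ _; linarith only [this, hs₂]
  have hs_le1 : s ≤ (k : ℝ) * δE / (2 * Cd) := (min_le_right _ _).trans (min_le_left _ _)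
  have hs_le2 : s ≤ (k : ℝ) / (2 * Cd * (B + 1)) := (min_le_right _ _).trans (min_le_right _ _)
  set η : ℝ := Cd * s / k with hη
  have hηpos : 0 < η := by positivity
  have hηδ : η ≤ δE := by
    rw [hη, div_le_iff₀ hkpos]
    have h := mul_le_mul_of_nonneg_left hs_le1 hCd.le
    have h2 : Cd * ((k : ℝ) * δE / (2 * Cd)) = k * δE / 2 := by field_simp
    rw [h2] at h
    linarith only [h, mul_pos hkpos hδE]
  have hηB : η * B < 1 := by
    have h := mul_le_mul_of_nonneg_left hs_le2 hCd.le
    have h2 : Cd * ((k : ℝ) / (2 * Cd * (B + 1))) = k / (2 * (B + 1)) := by field_simp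
    rw [h2] at h
    -- `η B = Cd s B / k ≤ B / (2 (B + 1)) < 1`
    have h3 : η * B ≤ B / (2 * (B + 1)) := by
      rw [hη]
      have : Cd * s / k * B = (Cd * s) * B / k := by ring
      rw [this, div_le_iff₀ hkpos]
      have h4 := mul_le_mul_of_nonneg_right h hBpos.le
      have h5 : (k : ℝ) / (2 * (B + 1)) * B = B / (2 * (B + 1)) * k := by ring
      linarith only [h4, h5]
    have h4 : B / (2 * (B + 1)) < 1 := by
      rw [div_lt_one (by positivity)]; linarith only [hBpos]
    exact h3.trans_lt h4
  -- facts on the closed disc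
  have hdisc : ∀ w : ℂ, ‖w‖ ≤ s → w ∈ U ∧ w ∈ ball (0 : ℂ) s₁ ∧ ‖fderiv ℝ û w‖ ≤ Cd * ‖w‖ ^ k ∧
      (∀ μ ∈ S, ‖û w - û (μ * w) + C μ * w ^ m μ‖ ≤ ‖C μ‖ * ‖w‖ ^ m μ / 2) ∧ F w ∈ V₀ := by
    intro w hw
    have hw' : w ∈ ball (0 : ℂ) s₂ := mem_ball_zero_iff.2 (hw.trans_lt hss₂)
    obtain ⟨h1, h2, h3, h4, h5⟩ := hs₂sub w hw'
    refine ⟨h1, h2, ?_, fun μ hμ => ?_, h5⟩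
    · rwa [Real.norm_of_nonneg (pow_nonneg (norm_nonneg _) _)] at h3
    · have := h4 μ hμ
      rw [Real.norm_of_nonneg (pow_nonneg (norm_nonneg _) _)] at this
      linarith only [this]
  have hsU : closedBall (0 : ℂ) s ⊆ U := fun w hw => (hdisc w (mem_closedBall_zero_iff.1 hw)).1
  -- ### the tangent planes of the cusp lie in a thin cone
  have hnorm_a : ∀ w : ℂ, ‖(k : ℂ) * w ^ (k - 1)‖ = k * ‖w‖ ^ (k - 1) := by
    intro w; rw [norm_mul, norm_pow, Complex.norm_natCast]
  have hcone : ∀ w : ℂ, ‖w‖ ≤ s → ∀ c : ℂ, ‖(F' w c).2‖ ≤ η * ‖(F' w c).1‖ := by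
    intro w hw c
    rw [hF'app]
    change ‖fderiv ℝ û w c‖ ≤ η * ‖c * ((k : ℂ) * w ^ (k - 1))‖
    have h1 : ‖fderiv ℝ û w c‖ ≤ Cd * ‖w‖ ^ k * ‖c‖ :=
      (ContinuousLinearMap.le_opNorm _ _).trans
        (mul_le_mul_of_nonneg_right (hdisc w hw).2.2.1 (norm_nonneg _))
    rw [norm_mul, hnorm_a]
    have h3 : ‖w‖ ^ k = ‖w‖ * ‖w‖ ^ (k - 1) := by
      rw [← pow_succ', Nat.sub_add_cancel hk1]
    rw [h3] at h1
    have h4 : Cd * (‖w‖ * ‖w‖ ^ (k - 1)) * ‖c‖ ≤ η * (‖c‖ * (k * ‖w‖ ^ (k - 1))) := by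
      have e1 : η * (‖c‖ * (k * ‖w‖ ^ (k - 1))) = Cd * s * (‖w‖ ^ (k - 1) * ‖c‖) := by
        rw [hη]; field_simp
      have e2 : Cd * (‖w‖ * ‖w‖ ^ (k - 1)) * ‖c‖ = Cd * ‖w‖ * (‖w‖ ^ (k - 1) * ‖c‖) := by ring
      rw [e1, e2]
      have h5 : 0 ≤ ‖w‖ ^ (k - 1) * ‖c‖ := by positivity
      exact mul_le_mul_of_nonneg_right (mul_le_mul_of_nonneg_left hw hCd.le) h5
    exact h1.trans h4
  have hF'1 : ∀ w, F' w 1 = (((k : ℂ) * w ^ (k - 1), fderiv ℝ û w 1) : ℂ × ℂ) := by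
    intro w; rw [hF'app, one_mul]
  -- ### the reference field and its model
  set e_ref : ℂ → ℂ × ℂ := fun w => E (Jt (F w)) (F' w 1) with he_ref
  have hJF : ∀ w : ℂ, ‖w‖ ≤ s → F w ∈ W ∧ ‖Jt (F w) - J₀‖ ≤ δJ := by
    intro w hw
    have h5 := (hdisc w hw).2.2.2.2
    exact ⟨h5.1, (mem_ball_iff_norm.1 h5.2).le⟩
  have happrox : ∀ w : ℂ, ‖w‖ ≤ s →
      ‖e_ref w - (G₁ ((k : ℂ) * w ^ (k - 1)), G₂ ((k : ℂ) * w ^ (k - 1)))‖ ≤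
        cG / 2 * ‖(k : ℂ) * w ^ (k - 1)‖ := by
    intro w hw
    have hv : ‖(F' w 1).2‖ ≤ δE * ‖(F' w 1).1‖ :=
      (hcone w hw 1).trans (mul_le_mul_of_nonneg_right hηδ (norm_nonneg _))
    have h1 := hmodel (Jt (F w)) ((hJF w hw).2.trans hδJE) (F' w 1) hv
    have hfst : (F' w 1).1 = (k : ℂ) * w ^ (k - 1) := by rw [hF'1]
    rw [hfst] at h1
    exact h1
  have he2_ge : ∀ w : ℂ, ‖w‖ ≤ s → cG / 2 * ‖(k : ℂ) * w ^ (k - 1)‖ ≤ ‖(e_ref w).2‖ := by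
    intro w hw
    have h1 : ‖(e_ref w).2 - G₂ ((k : ℂ) * w ^ (k - 1))‖ ≤ cG / 2 * ‖(k : ℂ) * w ^ (k - 1)‖ :=
      (norm_snd_le (e_ref w - (G₁ ((k : ℂ) * w ^ (k - 1)), G₂ ((k : ℂ) * w ^ (k - 1))))).trans
        (happrox w hw)
    have h2 := hcGle ((k : ℂ) * w ^ (k - 1))
    have h3 := norm_sub_norm_le (G₂ ((k : ℂ) * w ^ (k - 1))) (e_ref w).2
    rw [norm_sub_rev] at h1
    linarith only [h1, h2, h3]
  have he1_le : ∀ w : ℂ, ‖w‖ ≤ s → ‖(e_ref w).1‖ ≤ B * ‖(e_ref w).2‖ := by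
    intro w hw
    have h1 : ‖(e_ref w).1 - G₁ ((k : ℂ) * w ^ (k - 1))‖ ≤ cG / 2 * ‖(k : ℂ) * w ^ (k - 1)‖ :=
      (norm_fst_le (e_ref w - (G₁ ((k : ℂ) * w ^ (k - 1)), G₂ ((k : ℂ) * w ^ (k - 1))))).trans
        (happrox w hw)
    have h2 : ‖G₁ ((k : ℂ) * w ^ (k - 1))‖ ≤ ‖G₁‖ * ‖(k : ℂ) * w ^ (k - 1)‖ := G₁.le_opNorm _
    have h3 := norm_sub_norm_le (e_ref w).1 (G₁ ((k : ℂ) * w ^ (k - 1)))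
    have h4 := he2_ge w hw
    have hn := norm_nonneg ((k : ℂ) * w ^ (k - 1))
    have h5 : ‖(e_ref w).1‖ ≤ (‖G₁‖ + cG) * ‖(k : ℂ) * w ^ (k - 1)‖ := by
      have := mul_nonneg hcG.le hn
      linarith only [h1, h2, h3, this]
    have h6 : (‖G₁‖ + cG) * ‖(k : ℂ) * w ^ (k - 1)‖ ≤ B * ‖(e_ref w).2‖ := by
      have e1 : B * ‖(e_ref w).2‖ = (‖G₁‖ + cG) * (2 / cG * ‖(e_ref w).2‖) := by
        rw [hB]; ring
      rw [e1]
      refine mul_le_mul_of_nonneg_left ?_ (by positivity)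
      rw [div_mul_eq_mul_div, le_div_iff₀ hcG]
      linarith only [h4]
    exact h5.trans h6
  -- ### transversality of the reference field
  have htransF : ∀ w : ℂ, ‖w‖ ≤ s → w ≠ 0 →
      e_ref w ∉ LinearMap.range (F' w : ℂ →ₗ[ℝ] ℂ × ℂ) := by
    intro w hw hw0
    have hwU := (hdisc w hw).1
    have hws₁ := (hdisc w hw).2.1
    have hinjw : Function.Injective (F' w) := by
      have := himm w hws₁ hw0; rwa [hdFeq w hwU] at this
    have hinvw : ∀ c : ℂ, Jt (F w) (F' w c) ∈ LinearMap.range (F' w : ℂ →ₗ[ℝ] ℂ × ℂ) := by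
      intro c
      have := hFJ w hws₁ hw0 c
      rwa [hdFeq w hwU] at this
    obtain ⟨L, hLI, hL1, hLrange⟩ :=
      exists_intertwiner (Jt (F w)) (hJ2 _ (hJF w hw).1) (F' w) hinjw hinvw
    have hL10 : L 1 ≠ 0 := by
      rw [hL1]; intro h0; exact one_ne_zero (hinjw (by rw [h0, map_zero]))
    have := hEtrans (Jt (F w)) ((hJF w hw).2.trans hδJt) (hJ2 _ (hJF w hw).1) L 1 hLI hL10
    rw [hL1, hLrange] at this
    exact this
  -- continuity of the reference field on the closed disc
  have he_ref_cont : ContinuousOn e_ref (closedBall (0 : ℂ) s) := by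
    have h1 : ContinuousOn (fun w => Jt (F w)) (closedBall (0 : ℂ) s) :=
      hJc.comp (hFcd.continuousOn.mono hsU) fun w hw => (hJF w (mem_closedBall_zero_iff.1 hw)).1
    refine hEcont.comp (h1.prodMk (hF'c.mono hsU)) fun w hw => ⟨?_, mem_univ _⟩
    exact mem_closedBall_iff_norm.2 ((hJF w (mem_closedBall_zero_iff.1 hw)).2.trans hδJt)
  -- ### the winding number of the second component of the reference field
  set N : ℤ := wind (fun t => (e_ref (circleLoop 0 (s - s / 2) t)).2) with hN
  have hNabs : N.natAbs = k - 1 := by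
    have hr : 0 < s - s / 2 := by linarith only [hs]
    have hcirc : ∀ t, ‖circleLoop 0 (s - s / 2) t‖ = s - s / 2 := by
      intro t
      have := norm_circleLoop_sub_center 0 (s - s / 2) t
      rwa [sub_zero, abs_of_pos hr] at this
    have hcirc_le : ∀ t, ‖circleLoop 0 (s - s / 2) t‖ ≤ s := fun t => by
      rw [hcirc]; linarith only [hs]
    have hγ : IsNonvanishingLoop fun t => (k : ℂ) * circleLoop 0 (s - s / 2) t ^ (k - 1) := by
      have hl : IsNonvanishingLoop (circleLoop 0 (s - s / 2)) :=
        isNonvanishingLoop_circleLoop (by rw [norm_zero, abs_of_pos hr]; exact hr.ne)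
      have := (IsNonvanishingLoop.const (Nat.cast_ne_zero.2 hk0.ne' : (k : ℂ) ≠ 0)).mul
        (hl.zpow ((k - 1 : ℕ) : ℤ))
      simpa only [zpow_natCast] using this
    -- Rouché against the model `G₂ (k w^{k-1})`
    have hg : IsNonvanishingLoop fun t => G₂ ((k : ℂ) * circleLoop 0 (s - s / 2) t ^ (k - 1)) := by
      refine ⟨G₂.continuous.comp_continuousOn hγ.continuousOn, fun t _ h0 => ?_,
        by simp only [circleLoop_zero_eq]⟩
      have h1 := hcGle ((k : ℂ) * circleLoop 0 (s - s / 2) t ^ (k - 1))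
      rw [h0, norm_zero, hnorm_a, hcirc] at h1
      have : 0 < cG * (k * (s - s / 2) ^ (k - 1)) := by positivity
      linarith only [h1, this]
    have heq : wind (fun t => (e_ref (circleLoop 0 (s - s / 2) t)).2) =
        wind fun t => G₂ ((k : ℂ) * circleLoop 0 (s - s / 2) t ^ (k - 1)) := by
      refine wind_eq_of_norm_sub_lt ?_ (by simp only [circleLoop_zero_eq]) hg fun t _ => ?_
      · exact continuous_snd.comp_continuousOn (he_ref_cont.comp
          (continuous_circleLoop 0 _).continuousOn fun t _ => mem_closedBall_zero_iff.2 (hcirc_le t))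
      · have hw := hcirc_le t
        have h1 : ‖(e_ref (circleLoop 0 (s - s / 2) t)).2 -
            G₂ ((k : ℂ) * circleLoop 0 (s - s / 2) t ^ (k - 1))‖ ≤
            cG / 2 * ‖(k : ℂ) * circleLoop 0 (s - s / 2) t ^ (k - 1)‖ :=
          (norm_snd_le (e_ref _ - (G₁ _, G₂ _))).trans (happrox _ hw)
        have h2 := hcGle ((k : ℂ) * circleLoop 0 (s - s / 2) t ^ (k - 1))
        have h3 : 0 < ‖(k : ℂ) * circleLoop 0 (s - s / 2) t ^ (k - 1)‖ := by
          rw [hnorm_a, hcirc]; positivity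
        linarith only [h1, h2, mul_pos hcG h3]
    rw [hN, heq, natAbs_wind_comp_realLinear G₂ hG₂ hγ, natAbs_wind_deriv_pow hr hk1]
  have hNsum : (N.natAbs : ℤ) < ∑ μ ∈ S, (m μ : ℤ) := by rw [hNabs]; exact hsum
  -- ### the degree argument
  obtain ⟨δ₀, hδ₀, hcore⟩ := not_injOn_of_perturbed_cusp hk hC hm hNsum hU hs hsU hû
    (fun μ hμ z hz => (hdisc z hz).2.2.2.1 μ hμ)
    (hinj.mono fun z hz => (hdisc z (mem_closedBall_zero_iff.1 hz)).2.1)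
    (e_ref := e_ref) (θ₀ := s / 2) (by positivity) (by linarith only [hs])
    (he_ref_cont.mono fun w hw => mem_closedBall_zero_iff.2 hw.2)
    (fun w hw1 hw2 => by
      have hw0 : w ≠ 0 := fun h0 => by rw [h0, norm_zero] at hw1; linarith only [hw1, hs]
      exact himm w (hdisc w hw2).2.1 hw0)
    (fun w hw1 hw2 l hl => by
      have hw0 : w ≠ 0 := fun h0 => by rw [h0, norm_zero] at hw1; linarith only [hw1, hs]
      rw [show fderiv ℝ (fun z : ℂ => ((z ^ k, û z) : ℂ × ℂ)) w = F' w from hdFeq w (hdisc w hw2).1]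
      refine cone_transversal hηpos.le (T := LinearMap.range (F' w : ℂ →ₗ[ℝ] ℂ × ℂ)) ?_
        (htransF w hw2 hw0) (he1_le w hw2) hηB l hl
      rintro _ ⟨c, rfl⟩
      exact hcone w hw2 c)
    rfl
  -- ### uniform continuity data for the perturbed fields
  have hKF : IsCompact (F '' closedBall (0 : ℂ) s) :=
    (isCompact_closedBall _ _).image_of_continuousOn (hFcd.continuousOn.mono hsU)
  have hKFV : F '' closedBall (0 : ℂ) s ⊆ V₀ := by
    rintro _ ⟨w, hw, rfl⟩; exact (hdisc w (mem_closedBall_zero_iff.1 hw)).2.2.2.2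
  obtain ⟨ρ, hρ, hρsub⟩ := hKF.exists_cthickening_subset_open hV₀open hKFV
  have hKJ : IsCompact (cthickening ρ (F '' closedBall (0 : ℂ) s)) := hKF.cthickening
  have hKJW : cthickening ρ (F '' closedBall (0 : ℂ) s) ⊆ W := hρsub.trans inter_subset_left
  have hJuc := hKJ.uniformContinuousOn_of_continuous (hJc.mono hKJW)
  rw [Metric.uniformContinuousOn_iff] at hJuc
  obtain ⟨Mv, hMv⟩ : ∃ M, ∀ w ∈ closedBall (0 : ℂ) s, ‖F' w 1‖ ≤ M :=
    (isCompact_closedBall (0 : ℂ) s).exists_bound_of_continuousOn (hF'c.mono hsU)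
  set KE : Set (((ℂ × ℂ) →L[ℝ] (ℂ × ℂ)) × (ℂ × ℂ)) :=
    closedBall J₀ t₀ ×ˢ closedBall 0 (|Mv| + 1) with hKE
  have hKEc : IsCompact KE := (isCompact_closedBall _ _).prod (isCompact_closedBall _ _)
  have hEuc := hKEc.uniformContinuousOn_of_continuous (hEcont.mono fun p hp => ⟨hp.1, mem_univ _⟩)
  rw [Metric.uniformContinuousOn_iff] at hEuc
  obtain ⟨δa, hδa, hEclose⟩ := hEuc δ₀ hδ₀
  obtain ⟨δu, hδu, hJclose⟩ := hJuc (δa / 2) (by positivity)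
  -- ### the closeness constant
  set δ : ℝ := min δ₀ (min ρ (min (δu / 2) (min (δa / 2) (1 / 2)))) with hδ_def
  have hδpos : 0 < δ :=
    lt_min hδ₀ (lt_min hρ (lt_min (by positivity) (lt_min (by positivity) (by norm_num))))
  have hδδ₀ : δ ≤ δ₀ := min_le_left _ _
  have hδρ : δ ≤ ρ := (min_le_right _ _).trans (min_le_left _ _)
  have hδu' : δ < δu := by
    have : δ ≤ δu / 2 := (min_le_right _ _).trans ((min_le_right _ _).trans (min_le_left _ _))
    linarith only [this, hδu]
  have hδa' : δ < δa := by
    have : δ ≤ δa / 2 :=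
      (min_le_right _ _).trans ((min_le_right _ _).trans ((min_le_right _ _).trans (min_le_left _ _)))
    linarith only [this, hδa]
  have hδ1 : δ ≤ 1 / 2 :=
    (min_le_right _ _).trans ((min_le_right _ _).trans ((min_le_right _ _).trans (min_le_right _ _)))
  refine ⟨s, hs, δ, hδpos, hsU, ?_⟩
  intro g hg hg0 hg1 hgimm hgJ
  -- ### the perturbed curve stays in the good region
  have hgK : ∀ w ∈ closedBall (0 : ℂ) s, g w ∈ cthickening ρ (F '' closedBall (0 : ℂ) s) := by
    intro w hw
    refine Metric.mem_cthickening_of_dist_le (g w) (F w) ρ _ ⟨w, hw, rfl⟩ ?_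
    rw [dist_eq_norm]; exact (hg0 w hw).trans hδρ
  have hFK : ∀ w ∈ closedBall (0 : ℂ) s, F w ∈ cthickening ρ (F '' closedBall (0 : ℂ) s) :=
    fun w hw => Metric.mem_cthickening_of_dist_le (F w) (F w) ρ _ ⟨w, hw, rfl⟩
      (by rw [dist_self]; exact hρ.le)
  have hgV : ∀ w ∈ closedBall (0 : ℂ) s, g w ∈ W ∧ ‖Jt (g w) - J₀‖ ≤ t₀ := by
    intro w hw
    have h := hρsub (hgK w hw)
    exact ⟨h.1, (mem_ball_iff_norm.1 h.2).le.trans hδJt⟩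
  -- ### regularity of the perturbation
  have hgd : ∀ w ∈ closedBall (0 : ℂ) s, DifferentiableAt ℝ g w := fun w hw =>
    (hg.differentiableOn_one w (hsU hw)).differentiableAt (hU.mem_nhds (hsU hw))
  have hdgc : ContinuousOn (fun w => fderiv ℝ g w 1) (closedBall (0 : ℂ) s) :=
    ((hg.continuousOn_fderiv_of_isOpen hU le_rfl).mono hsU).clm_apply continuousOn_const
  -- ### the perturbed push-off field
  set e : ℂ → ℂ × ℂ := fun w => E (Jt (g w)) (fderiv ℝ g w 1) with he_def
  have he_cont : ContinuousOn e (closedBall (0 : ℂ) s) := by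
    have h1 : ContinuousOn (fun w => Jt (g w)) (closedBall (0 : ℂ) s) :=
      (hJc.mono hKJW).comp (hg.continuousOn.mono hsU) hgK
    exact hEcont.comp (h1.prodMk hdgc) fun w hw => ⟨mem_closedBall_iff_norm.2 (hgV w hw).2, mem_univ _⟩
  have he_trans : ∀ w ∈ closedBall (0 : ℂ) s,
      e w ∉ LinearMap.range (fderiv ℝ g w : ℂ →ₗ[ℝ] ℂ × ℂ) := by
    intro w hw
    obtain ⟨L, hLI, hL1, hLrange⟩ :=
      exists_intertwiner (Jt (g w)) (hJ2 _ (hgV w hw).1) (fderiv ℝ g w) (hgimm w hw) (hgJ w hw)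
    have hL10 : L 1 ≠ 0 := by
      rw [hL1]; intro h0; exact one_ne_zero (hgimm w hw (by rw [h0, map_zero]))
    have := hEtrans (Jt (g w)) (hgV w hw).2 (hJ2 _ (hgV w hw).1) L 1 hLI hL10
    rw [hL1, hLrange] at this
    exact this
  have he_close : ∀ w : ℂ, s - s / 2 ≤ ‖w‖ → ‖w‖ ≤ s → ‖e w - e_ref w‖ ≤ δ₀ := by
    intro w _ hw2
    have hw : w ∈ closedBall (0 : ℂ) s := mem_closedBall_zero_iff.2 hw2
    -- the two parameter points
    have hJdist : ‖Jt (g w) - Jt (F w)‖ < δa / 2 := by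
      have := hJclose (g w) (hgK w hw) (F w) (hFK w hw)
        (by rw [dist_eq_norm]; exact (hg0 w hw).trans_lt hδu')
      rwa [dist_eq_norm] at this
    have hvdist : ‖fderiv ℝ g w 1 - F' w 1‖ ≤ δ := by
      have h1 := hg1 w hw
      rw [hdFeq w (hsU hw)] at h1
      calc ‖fderiv ℝ g w 1 - F' w 1‖ = ‖(fderiv ℝ g w - F' w) 1‖ := rfl
        _ ≤ ‖fderiv ℝ g w - F' w‖ * ‖(1 : ℂ)‖ := ContinuousLinearMap.le_opNorm _ _
        _ ≤ δ := by rw [norm_one, mul_one]; exact h1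
    have hp : (Jt (g w), fderiv ℝ g w 1) ∈ KE := by
      refine ⟨mem_closedBall_iff_norm.2 (hgV w hw).2, mem_closedBall_zero_iff.2 ?_⟩
      have h1 := hMv w hw
      have h2 := norm_sub_norm_le (fderiv ℝ g w 1) (F' w 1)
      linarith only [h1, h2, hvdist, hδ1, le_abs_self Mv]
    have hq : (Jt (F w), F' w 1) ∈ KE := by
      refine ⟨mem_closedBall_iff_norm.2 ((hJF w hw2).2.trans hδJt), mem_closedBall_zero_iff.2 ?_⟩
      linarith only [hMv w hw, le_abs_self Mv]
    have hdist : dist (Jt (g w), fderiv ℝ g w 1) (Jt (F w), F' w 1) < δa := by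
      rw [Prod.dist_eq, dist_eq_norm, dist_eq_norm]
      exact max_lt (by linarith only [hJdist, hδa]) (hvdist.trans_lt hδa')
    have := hEclose _ hp _ hq hdist
    rw [dist_eq_norm] at this
    exact this.le
  -- ### conclude
  exact hcore g e hg (fun w hw => (hg0 w hw).trans hδδ₀) (fun w hw => (hg1 w hw).trans hδδ₀) hgimm
    he_cont he_trans he_close

end CuspDoublePoints

end Literature.Geometry.Symplectic
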